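/-
Copyright (c) 2026 the pub-hodgecm-mathlib formalisation cell (harness21).  Prover seat hodgecm-mathlib-LH10-p01 (g10): road «M6 ∕ F3 TOT-Λ BY OVER-ORDERS»
(LEAD T14-66; SIG-F3-5 v1 6925585c (S7) «reindex», carve (c14) for the F3-5 pen LH7-p04 (g12)), 2026-09-03: a sum over the glued family `{G(N″, b, c′)}` is the double
sum over `(b, N″)` of `weight × number of good classes mod ϖ^b` — the shape ★ F3-4 `overOrderLawSum_classOne_eq_phiTHn ∕ _classTwo_eq_phiTHprimen` consumes.
-/
import Literature.NumberTheory.Automorphic.GluedOverOrdersExhaustion   -- ★ (c3) p853024 (this seat): `exists_coe_eq_glued_of_glued_subset`; brings ★ F3-1a `GluedOverOrders` (`glued_eq_glued_iff`, `glued_subset_glued_iff`, `exists_subring_coe_eq_glued`, `gen_mem_glued`)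
import Mathlib.Algebra.BigOperators.Finprod
import HarnessLib

/-!
# Reindexing a sum over the glued family by `(b, N″, c′ mod ϖ^b)`

Topic `NumberTheory/Automorphic`; namespace `Literature.NumberTheory.Automorphic`.  THEOREMS ONLY (no definition, no instance, no notation, no named fact, no `sorry`).
Cell `pub/hodgecm-mathlib` (D-0151), crux H413 = `stmt-HodgeConjecture-24833`; road M6 → F3 «TOT-Λ by over-orders», step (S7) of SIG-F3-5 v1: after ★ F3-2b's partition
(`ncard_setOf_selfDual_stable_eq_finsum`, a `∑ᶠ O ∈ 𝓞`) with `𝓞` the glued family (★ (c13)), and the per-stratum verdict `#S_{G(N″,b,c′)} = wt(N″,b)·[Good(N″,b,c′)]`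
(★ F3-2a + ★ F3-3 (UG) + ★ (c8) + ★ (ii)), the total is `Σ_{b ≤ n} Σ_{N″ ≤ N} wt(N″,b) · #{c′ mod ϖ^b lawful, compatible, good}` — ★ F3-4's input shape with
`H N″ b := #{…}` (then ★ (c12) + ★ (S7b) evaluate `H`).

FRAME = ★ F3-1a ∕ (c3) (`j θ a k ϖO hθ hcoord`, `ϖO ≠ 0` a non-unit); `G(N″, b, c′)` spelled as ★'s set; LAWFUL `c′² − (ϖ^{N″}a c′ + ϖ^{2N″}k) ∈ (ϖ^b)`, COMPATIBLE
`ϖ^{N−N″}c′ − c ∈ (ϖ^b)` (★ `glued_subset_glued_iff`).  The family of SETS `𝓖 = {G(N″,b,c′) | N″ ≤ N, b ≤ n, lawful, compatible}`.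

* §1 `glued_eq_glued_of_sub_mem` (congruent parameters give the same order), `params_eq_of_glued_eq` (`G(N″,b,c′) = G(N‴,b′,c″) ⇒ N″ = N‴ ∧ b = b′ ∧ c′ ≡ c″`),
  `coe_image_glued_subrings_eq` (the subring family of ★ (c3)∕(c13) has exactly these underlying sets).
* §2 **`finsum_mem_glued_family_eq_sum_sum`** — for `f` with `f (G(N″,b,c′)) = if Good then wt N″ b else 0` on the family (`Good` a class function):
  `∑ᶠ T ∈ 𝓖, f T = ∑ b ∈ range (n+1), ∑ N″ ∈ range (N+1), wt N″ b * Nat.card {w : 𝒪⧸(ϖ^b) // ∃ c′, mk c′ = w ∧ lawful ∧ compatible ∧ Good}`.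

References: [Neukirch1999] J. Neukirch, *Algebraic Number Theory*, Grundlehren 322 (1999), Ch. I §12; [Rogawski1990] J. Rogawski, *Automorphic representations of unitary
groups in three variables*, §4.9 Lemma 4.9.3 p. 56, Prop. 4.9.1 (b) p. 55 (the count as a sum over levels); [Flicker1998UnitaryFL] Y. Flicker, the unit fundamental lemma
for `U(3)` (the closed forms the double sum feeds).
-/

set_option autoImplicit false

noncomputable section

open scoped ValuativeRel
open ValuativeRel Finset

namespace Literature.NumberTheory.Automorphic

variable {E : Type*} [Field E] [ValuativeRel E] {O₁ : Type*} [CommRing O₁] (j : 𝒪[E] →+* O₁) (θ : O₁) {a k : 𝒪[E]} (ϖO : 𝒪[E])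
  (hθ : θ * θ = j a * θ + j k) (hcoord : ∀ z : O₁, ∃! bc : 𝒪[E] × 𝒪[E], z = j bc.1 + j bc.2 * θ)

/-! ## §1 Parameters of a glued order -/

include hcoord in
/-- Congruent character values give the same glued order (★ `glued_eq_glued_iff`, ⇐). [cite: Neukirch1999, Ch. I §12] -/
theorem glued_eq_glued_of_sub_mem (hϖ0 : ϖO ≠ 0) (N'' b : ℕ) {c' c'' : 𝒪[E]} (h : c' - c'' ∈ Ideal.span {ϖO ^ b}) :
    {z : 𝒪[E] × O₁ | ∃ b₀ c₀ : 𝒪[E], z.2 = j b₀ + j c₀ * (j (ϖO ^ N'') * θ) ∧ z.1 - (b₀ + c₀ * c') ∈ Ideal.span {ϖO ^ b}} =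
      {z : 𝒪[E] × O₁ | ∃ b₀ c₀ : 𝒪[E], z.2 = j b₀ + j c₀ * (j (ϖO ^ N'') * θ) ∧ z.1 - (b₀ + c₀ * c'') ∈ Ideal.span {ϖO ^ b}} :=
  (glued_eq_glued_iff j θ ϖO hcoord N'' b c' c'' hϖ0).2 h

include hcoord in
/-- **Equal glued orders have equal parameters**: `G(N″,b,c′) = G(N‴,b′,c″) ⇒ N″ = N‴ ∧ b = b′ ∧ c′ ≡ c″ (mod ϖ^b)` (★ `glued_subset_glued_iff` both ways; `ϖ` a non-zero
non-unit). [cite: Neukirch1999, Ch. I §12] -/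
theorem params_eq_of_glued_eq (hϖ0 : ϖO ≠ 0) (hϖu : ¬ IsUnit ϖO) {N'' N''' b b' : ℕ} {c' c'' : 𝒪[E]}
    (h : {z : 𝒪[E] × O₁ | ∃ b₀ c₀ : 𝒪[E], z.2 = j b₀ + j c₀ * (j (ϖO ^ N'') * θ) ∧ z.1 - (b₀ + c₀ * c') ∈ Ideal.span {ϖO ^ b}} =
      {z : 𝒪[E] × O₁ | ∃ b₀ c₀ : 𝒪[E], z.2 = j b₀ + j c₀ * (j (ϖO ^ N''') * θ) ∧ z.1 - (b₀ + c₀ * c'') ∈ Ideal.span {ϖO ^ b'}}) :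
    N'' = N''' ∧ b = b' ∧ c' - c'' ∈ Ideal.span {ϖO ^ b} := by
  obtain ⟨h1, h2, -⟩ := (glued_subset_glued_iff j θ ϖO hcoord c' c'' hϖ0 hϖu).1 h.le
  obtain ⟨h3, h4, h5⟩ := (glued_subset_glued_iff j θ ϖO hcoord c'' c' hϖ0 hϖu).1 h.ge
  have hN : N'' = N''' := le_antisymm h3 h1
  have hb : b = b' := le_antisymm h4 h2
  subst hN; subst hb
  refine ⟨rfl, rfl, ?_⟩
  rw [Nat.sub_self, pow_zero, one_mul] at h5
  exact h5

include hθ hcoord in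
/-- **THE SUBRING FAMILY OF ★ (c3)∕(c13) HAS THE GLUED SETS AS UNDERLYING SETS**: `coe '' {S | δ(𝒪) ⊆ S ∧ G(N,n,c) ⊆ S} = {G(N″,b,c′) | N″ ≤ N, b ≤ n, lawful, compatible}`
(★ (c3) `exists_coe_eq_glued_of_glued_subset` for `⊆`; ★ F3-1a `exists_subring_coe_eq_glued` + `glued_subset_glued_iff` for `⊇`). [cite: Neukirch1999, Ch. I §12] -/
theorem coe_image_glued_subrings_eq [IsDiscreteValuationRing 𝒪[E]] (hϖ : Irreducible ϖO) (N n : ℕ) (c : 𝒪[E]) :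
    (fun S : Subring (𝒪[E] × O₁) => (S : Set (𝒪[E] × O₁))) ''
        {S : Subring (𝒪[E] × O₁) | (∀ y : 𝒪[E], ((y, j y) : 𝒪[E] × O₁) ∈ S) ∧
          {z : 𝒪[E] × O₁ | ∃ b₀ c₀ : 𝒪[E], z.2 = j b₀ + j c₀ * (j (ϖO ^ N) * θ) ∧ z.1 - (b₀ + c₀ * c) ∈ Ideal.span {ϖO ^ n}} ⊆ (S : Set (𝒪[E] × O₁))} =
      {T : Set (𝒪[E] × O₁) | ∃ (N'' b : ℕ) (c' : 𝒪[E]), N'' ≤ N ∧ b ≤ n ∧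
        c' * c' - (ϖO ^ N'' * a * c' + ϖO ^ (2 * N'') * k) ∈ Ideal.span {ϖO ^ b} ∧ ϖO ^ (N - N'') * c' - c ∈ Ideal.span {ϖO ^ b} ∧
        T = {z : 𝒪[E] × O₁ | ∃ b₀ c₀ : 𝒪[E], z.2 = j b₀ + j c₀ * (j (ϖO ^ N'') * θ) ∧ z.1 - (b₀ + c₀ * c') ∈ Ideal.span {ϖO ^ b}}} := by
  ext T
  simp only [Set.mem_image, Set.mem_setOf_eq]
  constructor
  · rintro ⟨S, ⟨hδ, hRS⟩, rfl⟩
    obtain ⟨N'', b, c', hN'', hb, hlaw, hcomp, hcoe⟩ := exists_coe_eq_glued_of_glued_subset j θ ϖO hθ hcoord hϖ S hδ hRS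
    exact ⟨N'', b, c', hN'', hb, hlaw, hcomp, hcoe⟩
  · rintro ⟨N'', b, c', hN'', hb, hlaw, hcomp, rfl⟩
    obtain ⟨S, hS⟩ := exists_subring_coe_eq_glued j θ ϖO hθ N'' b c' hlaw
    refine ⟨S, ⟨fun y => ?_, ?_⟩, hS⟩
    · rw [← SetLike.mem_coe, hS]
      exact ⟨y, 0, by simp, by simp⟩
    · rw [hS]
      exact glued_subset_glued j θ ϖO c c' hN'' hb hcomp

/-! ## §2 The reindexed sum -/

include hcoord in
/-- **REINDEX A SUM OVER THE GLUED FAMILY BY `(b, N″, c′ mod ϖ^b)`.**  `ϖ` a non-zero non-unit with finite quotients `𝒪⧸(ϖ^b)`; `f` a function on sets taking on each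
member `G(N″, b, c′)` of the family (`N″ ≤ N`, `b ≤ n`, lawful, compatible) the value `wt N″ b` if `Good N″ b c′` (`hf₁`) and `0` otherwise (`hf₀`), `Good` a class function
mod `ϖ^b`.  Then
`∑ᶠ T ∈ 𝓖, f T = Σ_{b ≤ n} Σ_{N″ ≤ N} wt(N″,b) · #{w ∈ 𝒪⧸(ϖ^b) | ∃ c′ ↦ w lawful ∧ compatible ∧ good}` — the family is the disjoint union over `(b, N″)` of the images
of these class sets under `w ↦ G(N″, b, out w)` (injective by ★ `glued_eq_glued_iff`).  [cite: Rogawski1990, §4.9 Lemma 4.9.3 p. 56, Prop. 4.9.1 (b) p. 55]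
[cite: Neukirch1999, Ch. I §12] -/
theorem finsum_mem_glued_family_eq_sum_sum (hϖ0 : ϖO ≠ 0) (hϖu : ¬ IsUnit ϖO) (hfin : ∀ b : ℕ, Finite (𝒪[E] ⧸ Ideal.span {ϖO ^ b}))
    (N n : ℕ) (c : 𝒪[E]) (f : Set (𝒪[E] × O₁) → ℕ) (wt : ℕ → ℕ → ℕ) (Good : ℕ → ℕ → 𝒪[E] → Prop)
    (hGood : ∀ (N'' b : ℕ) (c₁ c₂ : 𝒪[E]), c₁ - c₂ ∈ Ideal.span {ϖO ^ b} → (Good N'' b c₁ ↔ Good N'' b c₂))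
    (hf₁ : ∀ (N'' b : ℕ) (c' : 𝒪[E]), N'' ≤ N → b ≤ n →
      c' * c' - (ϖO ^ N'' * a * c' + ϖO ^ (2 * N'') * k) ∈ Ideal.span {ϖO ^ b} → ϖO ^ (N - N'') * c' - c ∈ Ideal.span {ϖO ^ b} → Good N'' b c' →
      f {z : 𝒪[E] × O₁ | ∃ b₀ c₀ : 𝒪[E], z.2 = j b₀ + j c₀ * (j (ϖO ^ N'') * θ) ∧ z.1 - (b₀ + c₀ * c') ∈ Ideal.span {ϖO ^ b}} = wt N'' b)
    (hf₀ : ∀ (N'' b : ℕ) (c' : 𝒪[E]), N'' ≤ N → b ≤ n →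
      c' * c' - (ϖO ^ N'' * a * c' + ϖO ^ (2 * N'') * k) ∈ Ideal.span {ϖO ^ b} → ϖO ^ (N - N'') * c' - c ∈ Ideal.span {ϖO ^ b} → ¬ Good N'' b c' →
      f {z : 𝒪[E] × O₁ | ∃ b₀ c₀ : 𝒪[E], z.2 = j b₀ + j c₀ * (j (ϖO ^ N'') * θ) ∧ z.1 - (b₀ + c₀ * c') ∈ Ideal.span {ϖO ^ b}} = 0) :
    ∑ᶠ T ∈ {T : Set (𝒪[E] × O₁) | ∃ (N'' b : ℕ) (c' : 𝒪[E]), N'' ≤ N ∧ b ≤ n ∧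
        c' * c' - (ϖO ^ N'' * a * c' + ϖO ^ (2 * N'') * k) ∈ Ideal.span {ϖO ^ b} ∧ ϖO ^ (N - N'') * c' - c ∈ Ideal.span {ϖO ^ b} ∧
        T = {z : 𝒪[E] × O₁ | ∃ b₀ c₀ : 𝒪[E], z.2 = j b₀ + j c₀ * (j (ϖO ^ N'') * θ) ∧ z.1 - (b₀ + c₀ * c') ∈ Ideal.span {ϖO ^ b}}}, f T =
      ∑ b ∈ range (n + 1), ∑ N'' ∈ range (N + 1), wt N'' b *
        Nat.card {w : 𝒪[E] ⧸ Ideal.span {ϖO ^ b} // ∃ c' : 𝒪[E], Ideal.Quotient.mk _ c' = w ∧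
          c' * c' - (ϖO ^ N'' * a * c' + ϖO ^ (2 * N'') * k) ∈ Ideal.span {ϖO ^ b} ∧ ϖO ^ (N - N'') * c' - c ∈ Ideal.span {ϖO ^ b} ∧ Good N'' b c'} := by
  classical
  -- abbreviations
  let G : ℕ → ℕ → 𝒪[E] → Set (𝒪[E] × O₁) := fun N'' b c' =>
    {z : 𝒪[E] × O₁ | ∃ b₀ c₀ : 𝒪[E], z.2 = j b₀ + j c₀ * (j (ϖO ^ N'') * θ) ∧ z.1 - (b₀ + c₀ * c') ∈ Ideal.span {ϖO ^ b}}
  let Law : ℕ → ℕ → 𝒪[E] → Prop := fun N'' b c' =>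
    c' * c' - (ϖO ^ N'' * a * c' + ϖO ^ (2 * N'') * k) ∈ Ideal.span {ϖO ^ b} ∧ ϖO ^ (N - N'') * c' - c ∈ Ideal.span {ϖO ^ b}
  -- `Law` and `Good` are class functions
  have hLaw : ∀ (N'' b : ℕ) (c₁ c₂ : 𝒪[E]), c₁ - c₂ ∈ Ideal.span {ϖO ^ b} → (Law N'' b c₁ ↔ Law N'' b c₂) := by
    intro N'' b c₁ c₂ h
    have key : ∀ c₁ c₂ : 𝒪[E], c₁ - c₂ ∈ Ideal.span {ϖO ^ b} → Law N'' b c₁ → Law N'' b c₂ := by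
      intro c₁ c₂ h ⟨h1, h2⟩
      refine ⟨?_, ?_⟩
      · have : c₂ * c₂ - (ϖO ^ N'' * a * c₂ + ϖO ^ (2 * N'') * k) =
            (c₁ * c₁ - (ϖO ^ N'' * a * c₁ + ϖO ^ (2 * N'') * k)) - (c₁ - c₂) * (c₁ + c₂ - ϖO ^ N'' * a) := by ring
        rw [this]; exact Ideal.sub_mem _ h1 (Ideal.mul_mem_right _ _ h)
      · have : ϖO ^ (N - N'') * c₂ - c = (ϖO ^ (N - N'') * c₁ - c) - ϖO ^ (N - N'') * (c₁ - c₂) := by ring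
        rw [this]; exact Ideal.sub_mem _ h2 (Ideal.mul_mem_left _ _ h)
    exact ⟨key c₁ c₂ h, key c₂ c₁ (by rw [← Ideal.neg_mem_iff, neg_sub]; exact h)⟩
  -- (1) the family as a disjoint union over `(b, N″) ∈ range × range` of the images `T(b, N″) = {G N″ b c′ | Law}`
  have hfam : {T : Set (𝒪[E] × O₁) | ∃ (N'' b : ℕ) (c' : 𝒪[E]), N'' ≤ N ∧ b ≤ n ∧
        c' * c' - (ϖO ^ N'' * a * c' + ϖO ^ (2 * N'') * k) ∈ Ideal.span {ϖO ^ b} ∧ ϖO ^ (N - N'') * c' - c ∈ Ideal.span {ϖO ^ b} ∧ T = G N'' b c'} =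
      ⋃ p ∈ ((range (n + 1) ×ˢ range (N + 1) : Finset (ℕ × ℕ)) : Set (ℕ × ℕ)), {T | ∃ c' : 𝒪[E], Law p.2 p.1 c' ∧ T = G p.2 p.1 c'} := by
    ext T
    simp only [Set.mem_setOf_eq, Set.mem_iUnion, Finset.coe_product, Set.mem_prod, Finset.mem_coe, Finset.mem_range, exists_prop, Prod.exists]
    constructor
    · rintro ⟨N'', b, c', hN'', hb, hlaw, hcomp, rfl⟩
      exact ⟨b, N'', ⟨by omega, by omega⟩, c', ⟨hlaw, hcomp⟩, rfl⟩
    · rintro ⟨b, N'', ⟨hb, hN''⟩, c', ⟨hlaw, hcomp⟩, rfl⟩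
      exact ⟨N'', b, c', by omega, by omega, hlaw, hcomp, rfl⟩
  -- each `T(b, N″)` is the injective image of the finite class set
  have hT : ∀ b N'' : ℕ, {T : Set (𝒪[E] × O₁) | ∃ c' : 𝒪[E], Law N'' b c' ∧ T = G N'' b c'} =
      (fun w : 𝒪[E] ⧸ Ideal.span {ϖO ^ b} => G N'' b (Quotient.out w)) ''
        {w | ∃ c' : 𝒪[E], Ideal.Quotient.mk _ c' = w ∧ Law N'' b c'} := by
    intro b N''
    ext T
    simp only [Set.mem_setOf_eq, Set.mem_image]
    constructor
    · rintro ⟨c', hlaw, rfl⟩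
      refine ⟨Ideal.Quotient.mk _ c', ⟨c', rfl, hlaw⟩, ?_⟩
      exact glued_eq_glued_of_sub_mem j θ ϖO hcoord hϖ0 N'' b (Ideal.Quotient.eq.1 (Ideal.Quotient.mk_out _))
    · rintro ⟨w, ⟨c', rfl, hlaw⟩, rfl⟩
      refine ⟨Quotient.out (Ideal.Quotient.mk (Ideal.span {ϖO ^ b}) c'), ?_, rfl⟩
      exact (hLaw N'' b c' _ (by rw [← Ideal.Quotient.eq, Ideal.Quotient.mk_out])).1 hlaw
  have hinj : ∀ b N'' : ℕ, Set.InjOn (fun w : 𝒪[E] ⧸ Ideal.span {ϖO ^ b} => G N'' b (Quotient.out w))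
      {w | ∃ c' : 𝒪[E], Ideal.Quotient.mk _ c' = w ∧ Law N'' b c'} := by
    intro b N'' w _ w' _ h
    obtain ⟨-, -, hc⟩ := params_eq_of_glued_eq j θ ϖO hcoord hϖ0 hϖu h
    rw [← Ideal.Quotient.mk_out w, ← Ideal.Quotient.mk_out w']
    exact Ideal.Quotient.eq.2 hc
  haveI : ∀ b : ℕ, Finite (𝒪[E] ⧸ Ideal.span {ϖO ^ b}) := hfin
  have hTfin : ∀ b N'' : ℕ, ({T : Set (𝒪[E] × O₁) | ∃ c' : 𝒪[E], Law N'' b c' ∧ T = G N'' b c'}).Finite := fun b N'' => by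
    rw [hT]; exact (Set.toFinite _).image _
  -- pairwise disjointness over `(b, N″)`
  have hdisj : (((range (n + 1) ×ˢ range (N + 1) : Finset (ℕ × ℕ)) : Set (ℕ × ℕ))).PairwiseDisjoint
      (fun p : ℕ × ℕ => {T : Set (𝒪[E] × O₁) | ∃ c' : 𝒪[E], Law p.2 p.1 c' ∧ T = G p.2 p.1 c'}) := by
    rintro ⟨b, N''⟩ _ ⟨b', N'''⟩ _ hne
    refine Set.disjoint_left.2 fun T hT1 hT2 => hne ?_
    obtain ⟨c', -, rfl⟩ := hT1
    obtain ⟨c'', -, hTT⟩ := hT2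
    obtain ⟨hN, hb, -⟩ := params_eq_of_glued_eq j θ ϖO hcoord hϖ0 hϖu hTT
    exact Prod.ext hb hN
  -- (2) assemble
  rw [hfam, finsum_mem_biUnion hdisj (Finset.finite_toSet _) (fun p _ => hTfin p.1 p.2), finsum_mem_coe_finset, Finset.sum_product]
  refine Finset.sum_congr rfl fun b hb => Finset.sum_congr rfl fun N'' hN'' => ?_
  rw [Finset.mem_range] at hb hN''
  rw [hT, finsum_mem_image (hinj b N'')]
  -- the summand on the class set
  have hval : ∀ w ∈ {w : 𝒪[E] ⧸ Ideal.span {ϖO ^ b} | ∃ c' : 𝒪[E], Ideal.Quotient.mk _ c' = w ∧ Law N'' b c'},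
      f (G N'' b (Quotient.out w)) = if Good N'' b (Quotient.out w) then wt N'' b else 0 := by
    rintro w ⟨c', rfl, hlaw⟩
    have hlaw' := (hLaw N'' b c' _ (by rw [← Ideal.Quotient.eq, Ideal.Quotient.mk_out])).1 hlaw
    by_cases hg : Good N'' b (Quotient.out (Ideal.Quotient.mk (Ideal.span {ϖO ^ b}) c'))
    · rw [if_pos hg]; exact hf₁ N'' b _ (by omega) (by omega) hlaw'.1 hlaw'.2 hg
    · rw [if_neg hg]; exact hf₀ N'' b _ (by omega) (by omega) hlaw'.1 hlaw'.2 hg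
  rw [finsum_mem_congr rfl hval]
  -- `∑ᶠ w ∈ W, (if Good then wt else 0) = wt * #(W ∩ Good)`
  set Wset : Set (𝒪[E] ⧸ Ideal.span {ϖO ^ b}) := {w | ∃ c' : 𝒪[E], Ideal.Quotient.mk _ c' = w ∧ Law N'' b c'} with hWset
  have hWfin : Wset.Finite := Set.toFinite _
  rw [finsum_mem_eq_finite_toFinset_sum _ hWfin, Finset.sum_ite, Finset.sum_const_zero, add_zero, Finset.sum_const, smul_eq_mul]
  rw [mul_comm]
  congr 1
  rw [← Set.ncard_coe_finset, ← Nat.card_coe_set_eq]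
  refine Nat.card_congr (Equiv.subtypeEquivRight fun w => ?_)
  simp only [Finset.coe_filter, Set.Finite.mem_toFinset, Set.mem_setOf_eq, hWset]
  constructor
  · rintro ⟨⟨c', rfl, hlaw⟩, hgood⟩
    exact ⟨c', rfl, hlaw.1, hlaw.2, (hGood N'' b _ _ (Ideal.Quotient.eq.1 (Ideal.Quotient.mk_out _))).1 hgood⟩
  · rintro ⟨c', rfl, hlaw, hcomp, hgood⟩
    exact ⟨⟨c', rfl, hlaw, hcomp⟩, (hGood N'' b _ _ (Ideal.Quotient.eq.1 (Ideal.Quotient.mk_out _))).2 hgood⟩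

end Literature.NumberTheory.Automorphic

end
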